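import Literature.NumberTheory.LFunctions.KloostermanFractionsCb
import Literature.NumberTheory.LFunctions.SquarefullDecomposition
import HarnessLib

/-!
# Bilinear forms with Kloosterman fractions: `𝓑 ≤ ‖α‖ 𝓒₁^{1/2}` and the square-free reduction of `𝓒₁`

Bettin–Chandee, *Trilinear forms with Kloosterman fractions* (arXiv:1502.00769), §2 (bfc) and
§6, with `A = 1`.  For `α` supported on `M < m ≤ 2M`,

  `‖𝓑(M,N,k;α,β)‖ ≤ ‖α‖ 𝓒₁^{1/2}`,  `𝓒₁ = Σ_{⌊M⌋ < m ≤ ⌊2M⌋} |X_m|²`,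
  `X_m = Σ_{n ≤ 2N, (m,n)=1} β_n e(k m̄/n)`

(`kfB_dyadic_CS` with `kfB_factor`), and writing `n = bn'` (`b` square-full, `n'` square-free,
`(b,n') = 1`), `X_m = Σ_b [(m,b)=1] X_{m,b}` with `X_{m,b} = kfInner k b (N/b) γ_b m`,
`γ_b(n') = β(bn') [n' square-free, (n',b)=1]` (`kfX_eq_sum_sqf`); by Cauchy–Schwarz with the
weights `b^{∓1/2}`,

  `𝓒₁ ≤ H · Σ_{b ≤ 2N square-full} b^{1/2} 𝓒_b(⌊M⌋,⌊2M⌋; N/b, γ_b)`,  `H = Σ_{b} b^{-1/2}`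

(`kfC1_le_sum_Cb`).  Also the trivial bounds `kfCb_triv`, `kfB_triv`.

## References
* S. Bettin, V. Chandee, Adv. Math. 328 (2018), arXiv:1502.00769, §2 (bfc), §6 (fdew).
  [cite: BettinChandee2018, §6]
* W. Duke, J. Friedlander, H. Iwaniec, Invent. Math. 128 (1997) 23–43, §5.
  [cite: DukeFriedlanderIwaniec1997, §5]
-/

noncomputable section

open Finset

namespace Literature.NumberTheory.LFunctions

/-! ### `𝓑 ≤ ‖α‖ 𝓒₁^{1/2}` on the dyadic range -/

/-- **Dyadic Cauchy–Schwarz**: for `α` supported on `M < m ≤ 2M` and any `X`,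
`‖Σ_{m ≤ 2M} α_m X_m‖ ≤ ‖α‖ (Σ_{⌊M⌋ < m ≤ ⌊2M⌋} |X_m|²)^{1/2}` (the terms with `m ≤ ⌊M⌋` vanish).
[cite: BettinChandee2018, §2 (bfc)] -/
theorem kfB_dyadic_CS (M : ℝ) (α X : ℕ → ℂ)
    (hα : ∀ m : ℕ, α m ≠ 0 → M < m ∧ (m : ℝ) ≤ 2 * M) :
    ‖∑ m ∈ Icc 1 ⌊2 * M⌋₊, α m * X m‖ ≤
      Real.sqrt (∑ m ∈ Icc 1 ⌊2 * M⌋₊, ‖α m‖ ^ 2) *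
        Real.sqrt (∑ m ∈ Ioc ⌊M⌋₊ ⌊2 * M⌋₊, ‖X m‖ ^ 2) := by
  have hsub : Ioc ⌊M⌋₊ ⌊2 * M⌋₊ ⊆ Icc 1 ⌊2 * M⌋₊ := by
    intro m hm
    rw [Finset.mem_Ioc] at hm
    exact Finset.mem_Icc.mpr ⟨by omega, hm.2⟩
  have hzero : ∀ m ∈ Icc 1 ⌊2 * M⌋₊, m ∉ Ioc ⌊M⌋₊ ⌊2 * M⌋₊ → α m * X m = 0 := by
    intro m hm hm'
    have hαm : α m = 0 := by
      by_contra h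
      have h1 := (hα m h).1
      apply hm'
      rw [Finset.mem_Ioc]
      refine ⟨?_, (Finset.mem_Icc.mp hm).2⟩
      rcases le_or_gt M 0 with hM | hM
      · rw [Nat.floor_of_nonpos hM]; exact (Finset.mem_Icc.mp hm).1
      · have : (⌊M⌋₊ : ℝ) ≤ M := Nat.floor_le hM.le
        exact_mod_cast (this.trans_lt h1 : (⌊M⌋₊ : ℝ) < m)
    rw [hαm, zero_mul]
  rw [← Finset.sum_subset hsub hzero]
  calc ‖∑ m ∈ Ioc ⌊M⌋₊ ⌊2 * M⌋₊, α m * X m‖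
      ≤ Real.sqrt (∑ m ∈ Ioc ⌊M⌋₊ ⌊2 * M⌋₊, ‖α m‖ ^ 2) *
          Real.sqrt (∑ m ∈ Ioc ⌊M⌋₊ ⌊2 * M⌋₊, ‖X m‖ ^ 2) :=
        DFI_norm_sum_mul_le_sqrt_mul_sqrt _ _ _
    _ ≤ Real.sqrt (∑ m ∈ Icc 1 ⌊2 * M⌋₊, ‖α m‖ ^ 2) *
          Real.sqrt (∑ m ∈ Ioc ⌊M⌋₊ ⌊2 * M⌋₊, ‖X m‖ ^ 2) := by
        refine mul_le_mul_of_nonneg_right (Real.sqrt_le_sqrt ?_) (Real.sqrt_nonneg _)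
        exact Finset.sum_le_sum_of_subset_of_nonneg hsub fun _ _ _ => by positivity

/-- Pulling `α_m` out of the inner sum of the bilinear form:
`Σ_n [(m,n)=1] α_m β_n e(k m̄/n) = α_m · X_m`. [folklore] -/
theorem kfB_factor (N : ℝ) (k : ℤ) (α β : ℕ → ℂ) (m : ℕ) :
    (∑ n ∈ Icc 1 ⌊2 * N⌋₊,
        if m.Coprime n then
          α m * β n * Complex.exp (2 * Real.pi * Complex.I *
            ((k : ℂ) * ((((m : ZMod n)⁻¹).val : ℕ) : ℂ) / (n : ℂ)))
        else 0) =
      α m * ∑ n ∈ Icc 1 ⌊2 * N⌋₊,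
        (if m.Coprime n then
          β n * Complex.exp (2 * Real.pi * Complex.I *
            ((k : ℂ) * ((((m : ZMod n)⁻¹).val : ℕ) : ℂ) / (n : ℂ)))
        else 0) := by
  rw [Finset.mul_sum]
  refine Finset.sum_congr rfl fun n _ => ?_
  split_ifs
  · ring
  · rw [mul_zero]

/-- **Trivial bound** `‖𝓑‖ ≤ (6MN)^{1/2} ‖α‖ ‖β‖` (`M, N ≥ 1/2`). [folklore] -/
theorem kfB_triv (M N : ℝ) (hM : 1 / 2 ≤ M) (hN : 0 ≤ N) (k : ℤ) (α β : ℕ → ℂ)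
    (hα : ∀ m : ℕ, α m ≠ 0 → M < m ∧ (m : ℝ) ≤ 2 * M) :
    ‖∑ m ∈ Icc 1 ⌊2 * M⌋₊, ∑ n ∈ Icc 1 ⌊2 * N⌋₊,
        if m.Coprime n then
          α m * β n * Complex.exp (2 * Real.pi * Complex.I *
            ((k : ℂ) * ((((m : ZMod n)⁻¹).val : ℕ) : ℂ) / (n : ℂ)))
        else 0‖ ≤
      Real.sqrt (6 * M * N) * Real.sqrt (∑ m ∈ Icc 1 ⌊2 * M⌋₊, ‖α m‖ ^ 2) *
        Real.sqrt (∑ n ∈ Icc 1 ⌊2 * N⌋₊, ‖β n‖ ^ 2) := by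
  rw [Finset.sum_congr rfl (fun m _ => kfB_factor N k α β m)]
  have h1 := kfB_dyadic_CS M α (fun m => ∑ n ∈ Icc 1 ⌊2 * N⌋₊,
    (if m.Coprime n then
      β n * Complex.exp (2 * Real.pi * Complex.I *
        ((k : ℂ) * ((((m : ZMod n)⁻¹).val : ℕ) : ℂ) / (n : ℂ)))
    else 0)) hα
  refine h1.trans ?_
  set A := Real.sqrt (∑ m ∈ Icc 1 ⌊2 * M⌋₊, ‖α m‖ ^ 2) with hA
  set Bn := ∑ n ∈ Icc 1 ⌊2 * N⌋₊, ‖β n‖ ^ 2 with hBn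
  have hBn0 : 0 ≤ Bn := Finset.sum_nonneg fun n _ => by positivity
  -- each `|X_m|² ≤ 2N ‖β‖²`
  have hXm : ∀ m : ℕ, ‖∑ n ∈ Icc 1 ⌊2 * N⌋₊,
      (if m.Coprime n then
        β n * Complex.exp (2 * Real.pi * Complex.I *
          ((k : ℂ) * ((((m : ZMod n)⁻¹).val : ℕ) : ℂ) / (n : ℂ)))
      else 0)‖ ^ 2 ≤ (2 * N) * Bn := by
    intro m
    have h2 : ‖∑ n ∈ Icc 1 ⌊2 * N⌋₊,
        (if m.Coprime n then
          β n * Complex.exp (2 * Real.pi * Complex.I *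
            ((k : ℂ) * ((((m : ZMod n)⁻¹).val : ℕ) : ℂ) / (n : ℂ)))
        else 0)‖ ≤ ∑ n ∈ Icc 1 ⌊2 * N⌋₊, ‖β n‖ := by
      refine (norm_sum_le _ _).trans (Finset.sum_le_sum fun n _ => ?_)
      split_ifs
      · rw [norm_mul, kft_norm_e k _ n, mul_one]
      · simp
    have h3 : (∑ n ∈ Icc 1 ⌊2 * N⌋₊, ‖β n‖) ^ 2 ≤
        (Icc 1 ⌊2 * N⌋₊).card * ∑ n ∈ Icc 1 ⌊2 * N⌋₊, ‖β n‖ ^ 2 := sq_sum_le_card_mul_sum_sq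
    have h4 : ((Icc 1 ⌊2 * N⌋₊).card : ℝ) ≤ 2 * N := by
      rw [Nat.card_Icc]
      have : ((⌊2 * N⌋₊ + 1 - 1 : ℕ) : ℝ) = ⌊2 * N⌋₊ := by simp
      rw [this]
      exact Nat.floor_le (by linarith)
    calc _ ≤ (∑ n ∈ Icc 1 ⌊2 * N⌋₊, ‖β n‖) ^ 2 :=
          pow_le_pow_left₀ (norm_nonneg _) h2 2
      _ ≤ (Icc 1 ⌊2 * N⌋₊).card * Bn := h3
      _ ≤ (2 * N) * Bn := mul_le_mul_of_nonneg_right h4 hBn0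
  have hcard : ((Ioc ⌊M⌋₊ ⌊2 * M⌋₊).card : ℝ) ≤ 3 * M := by
    rw [Nat.card_Ioc]
    have h1 : ((⌊2 * M⌋₊ - ⌊M⌋₊ : ℕ) : ℝ) ≤ (⌊2 * M⌋₊ : ℝ) - ⌊M⌋₊ + 0 := by
      rw [Nat.cast_sub (Nat.floor_le_floor (by linarith))]; linarith
    have h2 : (⌊2 * M⌋₊ : ℝ) ≤ 2 * M := Nat.floor_le (by linarith)
    have h3 : M < (⌊M⌋₊ : ℝ) + 1 := Nat.lt_floor_add_one M
    linarith
  have hC : ∑ m ∈ Ioc ⌊M⌋₊ ⌊2 * M⌋₊, ‖∑ n ∈ Icc 1 ⌊2 * N⌋₊,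
      (if m.Coprime n then
        β n * Complex.exp (2 * Real.pi * Complex.I *
          ((k : ℂ) * ((((m : ZMod n)⁻¹).val : ℕ) : ℂ) / (n : ℂ)))
      else 0)‖ ^ 2 ≤ 6 * M * N * Bn := by
    calc _ ≤ ∑ m ∈ Ioc ⌊M⌋₊ ⌊2 * M⌋₊, (2 * N) * Bn := Finset.sum_le_sum fun m _ => hXm m
      _ = ((Ioc ⌊M⌋₊ ⌊2 * M⌋₊).card : ℝ) * ((2 * N) * Bn) := by
          rw [Finset.sum_const, nsmul_eq_mul]
      _ ≤ (3 * M) * ((2 * N) * Bn) := mul_le_mul_of_nonneg_right hcard (by positivity)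
      _ = 6 * M * N * Bn := by ring
  calc A * Real.sqrt _ ≤ A * Real.sqrt (6 * M * N * Bn) :=
        mul_le_mul_of_nonneg_left (Real.sqrt_le_sqrt hC) (Real.sqrt_nonneg _)
    _ = Real.sqrt (6 * M * N) * A * Real.sqrt Bn := by
        rw [Real.sqrt_mul (by positivity)]; ring

/-! ### The square-free reduction of `X_m` and `𝓒₁` -/

/-- **`X_m = Σ_b [(m,b)=1] X_{m,b}`** (B–C §6): writing `n = bn'`,
`Σ_{n ≤ 2N,(m,n)=1} β_n e(k m̄/n) = Σ_{b ≤ 2N square-full} [(m,b)=1] · kfInner k b (N/b) γ_b m`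
with `γ_b(n') = β(bn')` for square-free `n'` coprime to `b` (and `0` otherwise).
[cite: BettinChandee2018, §6] -/
theorem kfX_eq_sum_sqf (k : ℤ) (N : ℝ) (β : ℕ → ℂ) (m : ℕ) :
    ∑ n ∈ Icc 1 ⌊2 * N⌋₊,
      (if m.Coprime n then
        β n * Complex.exp (2 * Real.pi * Complex.I *
          ((k : ℂ) * ((((m : ZMod n)⁻¹).val : ℕ) : ℂ) / (n : ℂ)))
      else 0) =
      ∑ b ∈ (Icc 1 ⌊2 * N⌋₊).filter (fun b => ∀ p ∈ b.primeFactors, p ^ 2 ∣ b),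
        (if m.Coprime b then
          kfInner k b (N / b) (fun n' => if (Squarefree n' ∧ n'.Coprime b) then β (b * n') else 0) m
        else 0) := by
  rw [sqf_regroup N (fun n => if m.Coprime n then
      β n * Complex.exp (2 * Real.pi * Complex.I *
        ((k : ℂ) * ((((m : ZMod n)⁻¹).val : ℕ) : ℂ) / (n : ℂ))) else 0)]
  refine Finset.sum_congr rfl fun b _ => ?_
  by_cases hmb : m.Coprime b
  · rw [if_pos hmb]
    unfold kfInner kfCoeff
    rw [Finset.sum_filter, Finset.sum_filter]
    refine Finset.sum_congr rfl fun n' _ => ?_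
    beta_reduce
    have hc : m.Coprime (b * n') ↔ n'.Coprime m := by
      rw [Nat.coprime_mul_iff_right, and_iff_right hmb, Nat.coprime_comm]
    by_cases h1 : Squarefree n' ∧ n'.Coprime b
    · by_cases h2 : n'.Coprime m
      · rw [if_pos h1, if_pos (hc.mpr h2), if_pos h2, if_pos h1]
        rfl
      · rw [if_pos h1, if_neg (fun h => h2 (hc.mp h)), if_neg h2]
    · rw [if_neg h1, if_neg h1]
      simp
  · rw [if_neg hmb]
    refine Finset.sum_eq_zero fun n' _ => ?_
    have hc : ¬ m.Coprime (b * n') := fun h => hmb (Nat.Coprime.coprime_mul_right_right h)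
    simp [hc]

/-- **Weighted Cauchy–Schwarz**: `‖Σ_i x_i‖² ≤ (Σ_i 1/w_i)(Σ_i w_i ‖x_i‖²)` for positive weights.
[folklore] -/
theorem kf_norm_sq_sum_le_weighted {ι : Type*} (s : Finset ι) (x : ι → ℂ) (w : ι → ℝ)
    (hw : ∀ i ∈ s, 0 < w i) :
    ‖∑ i ∈ s, x i‖ ^ 2 ≤ (∑ i ∈ s, 1 / w i) * ∑ i ∈ s, w i * ‖x i‖ ^ 2 := by
  have h1 : ‖∑ i ∈ s, x i‖ ≤ ∑ i ∈ s, (1 / Real.sqrt (w i)) * (Real.sqrt (w i) * ‖x i‖) := by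
    refine (norm_sum_le _ _).trans (le_of_eq (Finset.sum_congr rfl fun i hi => ?_))
    have : Real.sqrt (w i) ≠ 0 := (Real.sqrt_pos.mpr (hw i hi)).ne'
    field_simp
  have h2 := Finset.sum_mul_sq_le_sq_mul_sq s (fun i => 1 / Real.sqrt (w i))
    (fun i => Real.sqrt (w i) * ‖x i‖)
  have h3 : ∑ i ∈ s, (1 / Real.sqrt (w i)) ^ 2 = ∑ i ∈ s, 1 / w i := by
    refine Finset.sum_congr rfl fun i hi => ?_
    rw [div_pow, one_pow, Real.sq_sqrt (hw i hi).le]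
  have h4 : ∑ i ∈ s, (Real.sqrt (w i) * ‖x i‖) ^ 2 = ∑ i ∈ s, w i * ‖x i‖ ^ 2 := by
    refine Finset.sum_congr rfl fun i hi => ?_
    rw [mul_pow, Real.sq_sqrt (hw i hi).le]
  have h0 : 0 ≤ ∑ i ∈ s, (1 / Real.sqrt (w i)) * (Real.sqrt (w i) * ‖x i‖) :=
    Finset.sum_nonneg fun i hi => by
      have := hw i hi
      positivity
  calc ‖∑ i ∈ s, x i‖ ^ 2 ≤ (∑ i ∈ s, (1 / Real.sqrt (w i)) * (Real.sqrt (w i) * ‖x i‖)) ^ 2 :=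
        pow_le_pow_left₀ (norm_nonneg _) h1 2
    _ ≤ _ := h2
    _ = _ := by rw [h3, h4]

set_option maxHeartbeats 800000 in
/-- **The square-free reduction of `𝓒₁`** (B–C §6 (fdew) with `A = 1`):
`𝓒₁ ≤ H · Σ_{b ≤ 2N square-full} b^{1/2} 𝓒_b(⌊M⌋,⌊2M⌋; N/b, γ_b)` with `H = Σ_b b^{-1/2}` and
`𝓒_b(M₁,M₂;N',γ) = Σ_{M₁<m≤M₂,(m,b)=1} |kfInner k b N' γ m|²`. [cite: BettinChandee2018, §6] -/
theorem kfC1_le_sum_Cb (k : ℤ) (N : ℝ) (β : ℕ → ℂ) (M : ℝ) :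
    ∑ m ∈ Ioc ⌊M⌋₊ ⌊2 * M⌋₊, ‖∑ n ∈ Icc 1 ⌊2 * N⌋₊,
      (if m.Coprime n then
        β n * Complex.exp (2 * Real.pi * Complex.I *
          ((k : ℂ) * ((((m : ZMod n)⁻¹).val : ℕ) : ℂ) / (n : ℂ)))
      else 0)‖ ^ 2 ≤
      (∑ b ∈ (Icc 1 ⌊2 * N⌋₊).filter (fun b => ∀ p ∈ b.primeFactors, p ^ 2 ∣ b),
        1 / Real.sqrt (b : ℝ)) *
      ∑ b ∈ (Icc 1 ⌊2 * N⌋₊).filter (fun b => ∀ p ∈ b.primeFactors, p ^ 2 ∣ b),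
        Real.sqrt (b : ℝ) *
          ∑ m ∈ (Ioc ⌊M⌋₊ ⌊2 * M⌋₊).filter (fun m => m.Coprime b),
            ‖kfInner k b (N / b)
              (fun n' => if (Squarefree n' ∧ n'.Coprime b) then β (b * n') else 0) m‖ ^ 2 := by
  set Bset := (Icc 1 ⌊2 * N⌋₊).filter (fun b => ∀ p ∈ b.primeFactors, p ^ 2 ∣ b) with hBset
  set Mset := Ioc ⌊M⌋₊ ⌊2 * M⌋₊ with hMset
  set H : ℝ := ∑ b ∈ Bset, 1 / Real.sqrt (b : ℝ) with hH
  set Y : ℕ → ℕ → ℂ := fun b m => kfInner k b (N / b)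
    (fun n' => if (Squarefree n' ∧ n'.Coprime b) then β (b * n') else 0) m with hY
  have hw : ∀ b ∈ Bset, 0 < Real.sqrt (b : ℝ) := by
    intro b hb
    have : 0 < b := (Finset.mem_Icc.mp (Finset.mem_filter.mp hb).1).1
    exact Real.sqrt_pos.mpr (by exact_mod_cast this)
  -- per `m`
  have hm : ∀ m, ‖∑ n ∈ Icc 1 ⌊2 * N⌋₊,
      (if m.Coprime n then
        β n * Complex.exp (2 * Real.pi * Complex.I *
          ((k : ℂ) * ((((m : ZMod n)⁻¹).val : ℕ) : ℂ) / (n : ℂ)))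
      else 0)‖ ^ 2 ≤
      H * ∑ b ∈ Bset, Real.sqrt (b : ℝ) * ‖(if m.Coprime b then Y b m else 0)‖ ^ 2 := by
    intro m
    rw [kfX_eq_sum_sqf k N β m]
    exact kf_norm_sq_sum_le_weighted Bset _ _ hw
  calc _ ≤ ∑ m ∈ Mset, H * ∑ b ∈ Bset, Real.sqrt (b : ℝ) *
        ‖(if m.Coprime b then Y b m else 0)‖ ^ 2 := Finset.sum_le_sum fun m _ => hm m
    _ = H * ∑ b ∈ Bset, Real.sqrt (b : ℝ) * ∑ m ∈ Mset,
        ‖(if m.Coprime b then Y b m else 0)‖ ^ 2 := by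
        rw [← Finset.mul_sum, Finset.sum_comm]
        congr 1
        refine Finset.sum_congr rfl fun b _ => ?_
        rw [Finset.mul_sum]
    _ = H * ∑ b ∈ Bset, Real.sqrt (b : ℝ) * ∑ m ∈ Mset.filter (fun m => m.Coprime b),
        ‖Y b m‖ ^ 2 := by
        congr 1
        refine Finset.sum_congr rfl fun b _ => ?_
        congr 1
        rw [Finset.sum_filter]
        refine Finset.sum_congr rfl fun m _ => ?_
        split_ifs <;> simp

/-- **Trivial bound for `𝓒_b`**: `Σ_{M₁<m≤M₂,(m,b)=1} |kfInner k b N' γ m|² ≤ (M₂-M₁) 2N' ‖γ‖²`.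
[folklore] -/
theorem kfCb_triv (k : ℤ) (b : ℕ) {N' : ℝ} (hN' : 0 ≤ N') (γ : ℕ → ℂ) {M₁ M₂ : ℕ}
    (hM : M₁ ≤ M₂) :
    ∑ m ∈ (Ioc M₁ M₂).filter (fun m => m.Coprime b), ‖kfInner k b N' γ m‖ ^ 2 ≤
      ((M₂ : ℝ) - M₁) * ((2 * N') * ∑ n ∈ Icc 1 ⌊2 * N'⌋₊, ‖γ n‖ ^ 2) := by
  set I := Icc 1 ⌊2 * N'⌋₊ with hI
  set G := ∑ n ∈ I, ‖γ n‖ ^ 2 with hG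
  have hG0 : 0 ≤ G := Finset.sum_nonneg fun n _ => by positivity
  have hXm : ∀ m : ℕ, ‖kfInner k b N' γ m‖ ^ 2 ≤ (2 * N') * G := by
    intro m
    have h2 : ‖kfInner k b N' γ m‖ ≤ ∑ n ∈ I, ‖γ n‖ := by
      unfold kfInner kfCoeff
      refine (norm_sum_le _ _).trans ?_
      calc ∑ n ∈ I.filter (fun n => n.Coprime m), ‖γ n * kfPhase k (b * n) m‖
          = ∑ n ∈ I.filter (fun n => n.Coprime m), ‖γ n‖ := by
            refine Finset.sum_congr rfl fun n _ => ?_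
            unfold kfPhase
            rw [norm_mul, kft_norm_e k _ (b * n), mul_one]
        _ ≤ ∑ n ∈ I, ‖γ n‖ :=
            Finset.sum_le_sum_of_subset_of_nonneg (Finset.filter_subset _ _)
              fun _ _ _ => norm_nonneg _
    have h3 : (∑ n ∈ I, ‖γ n‖) ^ 2 ≤ I.card * G := sq_sum_le_card_mul_sum_sq
    have h4 : (I.card : ℝ) ≤ 2 * N' := by
      rw [hI, Nat.card_Icc]
      have : ((⌊2 * N'⌋₊ + 1 - 1 : ℕ) : ℝ) = ⌊2 * N'⌋₊ := by simp
      rw [this]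
      exact Nat.floor_le (by linarith)
    calc _ ≤ (∑ n ∈ I, ‖γ n‖) ^ 2 := pow_le_pow_left₀ (norm_nonneg _) h2 2
      _ ≤ I.card * G := h3
      _ ≤ (2 * N') * G := mul_le_mul_of_nonneg_right h4 hG0
  calc _ ≤ ∑ m ∈ (Ioc M₁ M₂).filter (fun m => m.Coprime b), (2 * N') * G :=
        Finset.sum_le_sum fun m _ => hXm m
    _ = (((Ioc M₁ M₂).filter (fun m => m.Coprime b)).card : ℝ) * ((2 * N') * G) := by
        rw [Finset.sum_const, nsmul_eq_mul]
    _ ≤ ((M₂ : ℝ) - M₁) * ((2 * N') * G) := by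
        refine mul_le_mul_of_nonneg_right ?_ (by positivity)
        have h1 : ((Ioc M₁ M₂).filter (fun m => m.Coprime b)).card ≤ M₂ - M₁ :=
          (Finset.card_filter_le _ _).trans (Nat.card_Ioc _ _).le
        have : (((M₂ - M₁ : ℕ)) : ℝ) = (M₂ : ℝ) - M₁ := Nat.cast_sub hM
        rw [← this]; exact_mod_cast h1

end Literature.NumberTheory.LFunctions

end
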